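import Summits.HubbardSuperconductivity.HubbardSuperconductivity.Theorems.WeakCouplingBCSKlLindhardEnclosureCeilStructuralOrd

/-!
# KL-MARGIN-SCAN reader (22) «kernel-lindhard-enclosure» — ceiling soundness for ORIENTED cells inside the root square, part 2/2: the five rules

The five ceiling RULE predicates in their final form — admissible `P`, one GUARDED grid cell INSIDE THE ROOT SQUARE and ORIENTED (`a ≤ b`,
`c ≤ d`), the rule's own certified outcome ⇒ `CeilValid`: `SameSideZeroOrd`, `CeilCrudeSoundOrd`, `CeilChordSoundOrd`, `CeilBdrySoundOrd`,
`CeilTipSoundOrd`; the case analysis `leafCeilSoundOrd_of_rules`; and `ceilSoundAt_of_rulesOrd : … → ∀ t, CeilSoundAt P t`.  These supersede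
the `…At` / `…In` forms as DISCHARGE TARGETS (those remain true reductions but over-quantify).  Honest framing: reductions only — the five rules
are NOT proved here (the same-side rule's content is `…CellSound.sameSide_ceilValid_zero`); floats are floats; nothing in this file asserts a KL
margin at any `t′ ≠ 0`, `K₃`, `U₀`, the window or B1g dominance; a Kohn–Luttinger instability statement is not ODLRO and nothing here proves
superconductivity in the Hubbard model.  (p1 g25, 2026-08-29.)
-/

noncomputable section

set_option linter.dupNamespace false

namespace Summit.HubbardSuperconductivity.HubbardSuperconductivity.Theorems.KlLindhardEnclosure

open Real Set MeasureTheory Literature.MathematicalPhysics.QuantumLattice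
open Summit.HubbardSuperconductivity.HubbardSuperconductivity.Theorems

/-- **SAME-SIDE RULE (oriented, of record)**. [folklore] -/
def SameSideZeroOrd (P : Params) : Prop :=
  ∀ (a b c d : ℤ) (k : Bool), P.admissible = true → P.InRoot a b c d → a ≤ b → c ≤ d →
    (P.cell (P.mkX a) (P.mkX b) (P.mkY c) (P.mkY d)).guards = true →
    P.status (P.cell (P.mkX a) (P.mkX b) (P.mkY c) (P.mkY d)).e1Lo (P.cell (P.mkX a) (P.mkX b) (P.mkY c) (P.mkY d)).e1Hi = some k →
    P.status (P.cell (P.mkX a) (P.mkX b) (P.mkY c) (P.mkY d)).e2Lo (P.cell (P.mkX a) (P.mkX b) (P.mkY c) (P.mkY d)).e2Hi = some k →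
      P.CeilValid a b c d 0

/-- **CRUDE-CEILING RULE (oriented, of record)**. [folklore] -/
def CeilCrudeSoundOrd (P : Params) : Prop :=
  ∀ (a b c d v : ℤ), P.admissible = true → P.InRoot a b c d → a ≤ b → c ≤ d →
    (P.cell (P.mkX a) (P.mkX b) (P.mkY c) (P.mkY d)).guards = true →
    P.ceilCrude (P.cell (P.mkX a) (P.mkX b) (P.mkY c) (P.mkY d)) (P.mkX a) (P.mkX b) (P.mkY c) (P.mkY d) = some v →
      P.CeilValid a b c d v

/-- **CHORD-CEILING RULE (oriented, of record)**. [folklore] -/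
def CeilChordSoundOrd (P : Params) : Prop :=
  ∀ (a b c d : ℤ) (k : Bool) (u : ℤ), P.admissible = true → P.InRoot a b c d → a ≤ b → c ≤ d →
    (P.cell (P.mkX a) (P.mkX b) (P.mkY c) (P.mkY d)).guards = true →
    P.status (P.cell (P.mkX a) (P.mkX b) (P.mkY c) (P.mkY d)).e1Lo (P.cell (P.mkX a) (P.mkX b) (P.mkY c) (P.mkY d)).e1Hi = some k →
    P.status (P.cell (P.mkX a) (P.mkX b) (P.mkY c) (P.mkY d)).e2Lo (P.cell (P.mkX a) (P.mkX b) (P.mkY c) (P.mkY d)).e2Hi = some (!k) →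
    P.ceilChord (P.cell (P.mkX a) (P.mkX b) (P.mkY c) (P.mkY d)) k (P.mkX a) (P.mkX b) (P.mkY c) (P.mkY d) = some u →
      P.CeilValid a b c d u

/-- **MAJORISED-HYPERBOLA RULE (oriented, of record)**. [folklore] -/
def CeilBdrySoundOrd (P : Params) : Prop :=
  ∀ (a b c d : ℤ) (sh far : Bool) (τx τy : ℕ) (u : ℤ), P.admissible = true → P.InRoot a b c d → a ≤ b → c ≤ d →
    (P.cell (P.mkX a) (P.mkX b) (P.mkY c) (P.mkY d)).guards = true →
    P.status (P.cell (P.mkX a) (P.mkX b) (P.mkY c) (P.mkY d)).e1Lo (P.cell (P.mkX a) (P.mkX b) (P.mkY c) (P.mkY d)).e1Hi = (if sh then some far else none) →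
    P.status (P.cell (P.mkX a) (P.mkX b) (P.mkY c) (P.mkY d)).e2Lo (P.cell (P.mkX a) (P.mkX b) (P.mkY c) (P.mkY d)).e2Hi = (if sh then none else some far) →
    P.ceilBdry (P.cell (P.mkX a) (P.mkX b) (P.mkY c) (P.mkY d)) sh (!far) τx τy (P.mkX a) (P.mkX b) (P.mkY c) (P.mkY d) = some u →
      P.CeilValid a b c d u

/-- **TIP RULE (oriented, of record)**. [folklore] -/
def CeilTipSoundOrd (P : Params) : Prop :=
  ∀ (a b c d : ℤ) (τx σx τy σy τx' σx' τy' σy' : ℕ) (u : ℤ), P.admissible = true → P.InRoot a b c d → a ≤ b → c ≤ d →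
    (P.cell (P.mkX a) (P.mkX b) (P.mkY c) (P.mkY d)).guards = true →
    P.status (P.cell (P.mkX a) (P.mkX b) (P.mkY c) (P.mkY d)).e1Lo (P.cell (P.mkX a) (P.mkX b) (P.mkY c) (P.mkY d)).e1Hi = none →
    P.status (P.cell (P.mkX a) (P.mkX b) (P.mkY c) (P.mkY d)).e2Lo (P.cell (P.mkX a) (P.mkX b) (P.mkY c) (P.mkY d)).e2Hi = none →
    P.ceilTip (P.cell (P.mkX a) (P.mkX b) (P.mkY c) (P.mkY d)) τx σx τy σy τx' σx' τy' σy' (P.mkX a) (P.mkX b) (P.mkY c) (P.mkY d) = some u →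
      P.CeilValid a b c d u

/-- **THE ORIENTED PER-LEAF CEILING DEBT IS THE FIVE ORIENTED RULES.** -/
theorem leafCeilSoundOrd_of_rules (P : Params) (hSS : SameSideZeroOrd P) (hCr : CeilCrudeSoundOrd P) (hCh : CeilChordSoundOrd P)
    (hB : CeilBdrySoundOrd P) (hT : CeilTipSoundOrd P) : LeafCeilSoundOrd P := by
  intro bd tp a b c d N hP hin hab hcd h
  set x0 := P.mkX a with hx0
  set x1 := P.mkX b with hx1
  set y0 := P.mkY c with hy0
  set y1 := P.mkY d with hy1
  by_cases hg : (P.cell x0 x1 y0 y1).guards = true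
  · rcases hs1 : P.status (P.cell x0 x1 y0 y1).e1Lo (P.cell x0 x1 y0 y1).e1Hi with _ | ⟨_ | _⟩ <;>
      rcases hs2 : P.status (P.cell x0 x1 y0 y1).e2Lo (P.cell x0 x1 y0 y1).e2Hi with _ | ⟨_ | _⟩
    · -- none, none : tip cell
      rcases tp with _ | ⟨τx, σx, τy, σy, τx', σx', τy', σy'⟩
      · simp only [Params.leaf, hg, hs1, hs2, Bool.not_true, Bool.false_eq_true, ↓reduceIte] at h
        split at h
        · rename_i u v hu hv
          simp only [Option.some.injEq] at h
          have hN : N = min u v := by omega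
          subst hN
          exact P.ceilValid_min (hT a b c d _ _ _ _ _ _ _ _ u hP hin hab hcd hg hs1 hs2 hu) (hCr a b c d v hP hin hab hcd hg hv)
        · rename_i u hu hv
          simp only [Option.some.injEq] at h
          have hN : N = u := by omega
          subst hN
          exact hT a b c d _ _ _ _ _ _ _ _ _ hP hin hab hcd hg hs1 hs2 hu
        · rename_i v hu hv
          simp only [Option.some.injEq] at h
          have hN : N = v := by omega
          subst hN
          exact hCr a b c d _ hP hin hab hcd hg hv
        · simp at h
      · simp only [Params.leaf, hg, hs1, hs2, Bool.not_true, Bool.false_eq_true, ↓reduceIte] at h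
        split at h
        · rename_i u v hu hv
          simp only [Option.some.injEq] at h
          have hN : N = min u v := by omega
          subst hN
          exact P.ceilValid_min (hT a b c d _ _ _ _ _ _ _ _ u hP hin hab hcd hg hs1 hs2 hu) (hCr a b c d v hP hin hab hcd hg hv)
        · rename_i u hu hv
          simp only [Option.some.injEq] at h
          have hN : N = u := by omega
          subst hN
          exact hT a b c d _ _ _ _ _ _ _ _ _ hP hin hab hcd hg hs1 hs2 hu
        · rename_i v hu hv
          simp only [Option.some.injEq] at h
          have hN : N = v := by omega
          subst hN
          exact hCr a b c d _ hP hin hab hcd hg hv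
        · simp at h
    · -- none, some false
      rcases bd with _ | ⟨σx, σy, τx, τy⟩
      · simp only [Params.leaf, hg, hs1, hs2, Bool.not_true, Bool.not_false, Bool.false_eq_true, ↓reduceIte] at h
        split at h
        · rename_i u v hu hv
          simp only [Option.some.injEq] at h
          have hN : N = min u v := by omega
          subst hN
          exact P.ceilValid_min (hB a b c d false false _ _ u hP hin hab hcd hg (by simpa using hs1) (by simpa using hs2) hu) (hCr a b c d v hP hin hab hcd hg hv)
        · rename_i u hu hv
          simp only [Option.some.injEq] at h
          have hN : N = u := by omega
          subst hN
          exact hB a b c d false false _ _ _ hP hin hab hcd hg (by simpa using hs1) (by simpa using hs2) hu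
        · rename_i v hu hv
          simp only [Option.some.injEq] at h
          have hN : N = v := by omega
          subst hN
          exact hCr a b c d _ hP hin hab hcd hg hv
        · simp at h
      · simp only [Params.leaf, hg, hs1, hs2, Bool.not_true, Bool.not_false, Bool.false_eq_true, ↓reduceIte] at h
        split at h
        · rename_i u v hu hv
          simp only [Option.some.injEq] at h
          have hN : N = min u v := by omega
          subst hN
          exact P.ceilValid_min (hB a b c d false false _ _ u hP hin hab hcd hg (by simpa using hs1) (by simpa using hs2) hu) (hCr a b c d v hP hin hab hcd hg hv)
        · rename_i u hu hv
          simp only [Option.some.injEq] at h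
          have hN : N = u := by omega
          subst hN
          exact hB a b c d false false _ _ _ hP hin hab hcd hg (by simpa using hs1) (by simpa using hs2) hu
        · rename_i v hu hv
          simp only [Option.some.injEq] at h
          have hN : N = v := by omega
          subst hN
          exact hCr a b c d _ hP hin hab hcd hg hv
        · simp at h
    · -- none, some true
      rcases bd with _ | ⟨σx, σy, τx, τy⟩
      · simp only [Params.leaf, hg, hs1, hs2, Bool.not_true, Bool.false_eq_true, ↓reduceIte] at h
        split at h
        · rename_i u v hu hv
          simp only [Option.some.injEq] at h
          have hN : N = min u v := by omega
          subst hN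
          exact P.ceilValid_min (hB a b c d false true _ _ u hP hin hab hcd hg (by simpa using hs1) (by simpa using hs2) hu) (hCr a b c d v hP hin hab hcd hg hv)
        · rename_i u hu hv
          simp only [Option.some.injEq] at h
          have hN : N = u := by omega
          subst hN
          exact hB a b c d false true _ _ _ hP hin hab hcd hg (by simpa using hs1) (by simpa using hs2) hu
        · rename_i v hu hv
          simp only [Option.some.injEq] at h
          have hN : N = v := by omega
          subst hN
          exact hCr a b c d _ hP hin hab hcd hg hv
        · simp at h
      · simp only [Params.leaf, hg, hs1, hs2, Bool.not_true, Bool.false_eq_true, ↓reduceIte] at h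
        split at h
        · rename_i u v hu hv
          simp only [Option.some.injEq] at h
          have hN : N = min u v := by omega
          subst hN
          exact P.ceilValid_min (hB a b c d false true _ _ u hP hin hab hcd hg (by simpa using hs1) (by simpa using hs2) hu) (hCr a b c d v hP hin hab hcd hg hv)
        · rename_i u hu hv
          simp only [Option.some.injEq] at h
          have hN : N = u := by omega
          subst hN
          exact hB a b c d false true _ _ _ hP hin hab hcd hg (by simpa using hs1) (by simpa using hs2) hu
        · rename_i v hu hv
          simp only [Option.some.injEq] at h
          have hN : N = v := by omega
          subst hN
          exact hCr a b c d _ hP hin hab hcd hg hv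
        · simp at h
    · -- some false, none
      rcases bd with _ | ⟨σx, σy, τx, τy⟩
      · simp only [Params.leaf, hg, hs1, hs2, Bool.not_true, Bool.not_false, Bool.false_eq_true, ↓reduceIte] at h
        split at h
        · rename_i u v hu hv
          simp only [Option.some.injEq] at h
          have hN : N = min u v := by omega
          subst hN
          exact P.ceilValid_min (hB a b c d true false _ _ u hP hin hab hcd hg (by simpa using hs1) (by simpa using hs2) hu) (hCr a b c d v hP hin hab hcd hg hv)
        · rename_i u hu hv
          simp only [Option.some.injEq] at h
          have hN : N = u := by omega
          subst hN
          exact hB a b c d true false _ _ _ hP hin hab hcd hg (by simpa using hs1) (by simpa using hs2) hu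
        · rename_i v hu hv
          simp only [Option.some.injEq] at h
          have hN : N = v := by omega
          subst hN
          exact hCr a b c d _ hP hin hab hcd hg hv
        · simp at h
      · simp only [Params.leaf, hg, hs1, hs2, Bool.not_true, Bool.not_false, Bool.false_eq_true, ↓reduceIte] at h
        split at h
        · rename_i u v hu hv
          simp only [Option.some.injEq] at h
          have hN : N = min u v := by omega
          subst hN
          exact P.ceilValid_min (hB a b c d true false _ _ u hP hin hab hcd hg (by simpa using hs1) (by simpa using hs2) hu) (hCr a b c d v hP hin hab hcd hg hv)
        · rename_i u hu hv
          simp only [Option.some.injEq] at h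
          have hN : N = u := by omega
          subst hN
          exact hB a b c d true false _ _ _ hP hin hab hcd hg (by simpa using hs1) (by simpa using hs2) hu
        · rename_i v hu hv
          simp only [Option.some.injEq] at h
          have hN : N = v := by omega
          subst hN
          exact hCr a b c d _ hP hin hab hcd hg hv
        · simp at h
    · -- some false, some false : same side
      simp only [Params.leaf, hg, hs1, hs2, Bool.not_true, Bool.false_eq_true, ↓reduceIte] at h
      simp only [Option.some.injEq] at h
      have hN : N = 0 := by omega
      subst hN
      exact hSS a b c d false hP hin hab hcd hg hs1 hs2
    · -- some false, some true : two-shell kind II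
      simp only [Params.leaf, hg, hs1, hs2, Bool.not_true, Bool.false_eq_true, ↓reduceIte] at h
      split at h
      · rename_i u v hu hv
        simp only [Option.some.injEq] at h
        have hN : N = min u v := by omega
        subst hN
        exact P.ceilValid_min (hCh a b c d false u hP hin hab hcd hg hs1 hs2 hu) (hCr a b c d v hP hin hab hcd hg hv)
      · rename_i u hu hv
        simp only [Option.some.injEq] at h
        have hN : N = u := by omega
        subst hN
        exact hCh a b c d false _ hP hin hab hcd hg hs1 hs2 hu
      · rename_i v hu hv
        simp only [Option.some.injEq] at h
        have hN : N = v := by omega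
        subst hN
        exact hCr a b c d _ hP hin hab hcd hg hv
      · simp at h
    · -- some true, none
      rcases bd with _ | ⟨σx, σy, τx, τy⟩
      · simp only [Params.leaf, hg, hs1, hs2, Bool.not_true, Bool.false_eq_true, ↓reduceIte] at h
        split at h
        · rename_i u v hu hv
          simp only [Option.some.injEq] at h
          have hN : N = min u v := by omega
          subst hN
          exact P.ceilValid_min (hB a b c d true true _ _ u hP hin hab hcd hg (by simpa using hs1) (by simpa using hs2) hu) (hCr a b c d v hP hin hab hcd hg hv)
        · rename_i u hu hv
          simp only [Option.some.injEq] at h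
          have hN : N = u := by omega
          subst hN
          exact hB a b c d true true _ _ _ hP hin hab hcd hg (by simpa using hs1) (by simpa using hs2) hu
        · rename_i v hu hv
          simp only [Option.some.injEq] at h
          have hN : N = v := by omega
          subst hN
          exact hCr a b c d _ hP hin hab hcd hg hv
        · simp at h
      · simp only [Params.leaf, hg, hs1, hs2, Bool.not_true, Bool.false_eq_true, ↓reduceIte] at h
        split at h
        · rename_i u v hu hv
          simp only [Option.some.injEq] at h
          have hN : N = min u v := by omega
          subst hN
          exact P.ceilValid_min (hB a b c d true true _ _ u hP hin hab hcd hg (by simpa using hs1) (by simpa using hs2) hu) (hCr a b c d v hP hin hab hcd hg hv)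
        · rename_i u hu hv
          simp only [Option.some.injEq] at h
          have hN : N = u := by omega
          subst hN
          exact hB a b c d true true _ _ _ hP hin hab hcd hg (by simpa using hs1) (by simpa using hs2) hu
        · rename_i v hu hv
          simp only [Option.some.injEq] at h
          have hN : N = v := by omega
          subst hN
          exact hCr a b c d _ hP hin hab hcd hg hv
        · simp at h
    · -- some true, some false : two-shell kind I
      simp only [Params.leaf, hg, hs1, hs2, Bool.not_true, Bool.false_eq_true, ↓reduceIte] at h
      split at h
      · rename_i u v hu hv
        simp only [Option.some.injEq] at h
        have hN : N = min u v := by omega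
        subst hN
        exact P.ceilValid_min (hCh a b c d true u hP hin hab hcd hg hs1 hs2 hu) (hCr a b c d v hP hin hab hcd hg hv)
      · rename_i u hu hv
        simp only [Option.some.injEq] at h
        have hN : N = u := by omega
        subst hN
        exact hCh a b c d true _ hP hin hab hcd hg hs1 hs2 hu
      · rename_i v hu hv
        simp only [Option.some.injEq] at h
        have hN : N = v := by omega
        subst hN
        exact hCr a b c d _ hP hin hab hcd hg hv
      · simp at h
    · -- some true, some true : same side
      simp only [Params.leaf, hg, hs1, hs2, Bool.not_true, Bool.false_eq_true, ↓reduceIte] at h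
      simp only [Option.some.injEq] at h
      have hN : N = 0 := by omega
      subst hN
      exact hSS a b c d true hP hin hab hcd hg hs1 hs2
  · -- failed guards
    have hg' : (P.cell x0 x1 y0 y1).guards = false := by simpa using hg
    simp [Params.leaf, hg'] at h

/-- **CEILING SOUNDNESS FROM THE FIVE ORIENTED RULES, for every certificate tree** — the discharge route of record. -/
theorem ceilSoundAt_of_rulesOrd (P : Params) (hSS : SameSideZeroOrd P) (hCr : CeilCrudeSoundOrd P) (hCh : CeilChordSoundOrd P)
    (hB : CeilBdrySoundOrd P) (hT : CeilTipSoundOrd P) (t : QB) : CeilSoundAt P t :=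
  ceilSoundAt_of_leafCeilSoundOrd P (leafCeilSoundOrd_of_rules P hSS hCr hCh hB hT) t

end Summit.HubbardSuperconductivity.HubbardSuperconductivity.Theorems.KlLindhardEnclosure

end
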